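import Summits.Schanuel.Schanuel.Theorems.RootDecomp1KHyper18

/-!
# RootDecomp1KHyper — part 19 of the «HyperCarving» port wave (lens 6, gen 9 = ROUND 4 of route-Schanuel-RootDecomp1K; 19 parts planned)

Mechanical port (census-1 gen 7, dependency closure; tools census/tools/gen7/portkit2.py + build_l6g9.py) of §17 of HOME/decomp-schanuel-lens-6/g9/HyperCarving.lean
(sha256 aba5c91f…, 8041 l; critic CLEARED FOR TYPING 2026-08-30T13:33:07Z; writer PATH A″ rev 5–8) together with the §§0–16 declarations it depends on
(nothing of the node was in the tree before except RootDecomp1KLinLiouvilleSplit and the Literature fact NesterenkoWaldschmidt1996_thm_5_1).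
This part: node lines 7757–7994 (9 declarations: irreducible_den_mul_X_sub_num, weilHeight₁_ratCast_le, exp_one_le_log_sixteen, explicitRatExpApprox_of_NW1996, algebraicIndependent_exp_of_hyperLiouville_NW, hyperCell_sq_NW …).
All parts share the namespace `Summit.Schanuel.Schanuel.Theorems.RootDecomp1KHyper` (node sub-namespace `HyperCell` reproduced); statements and proofs
are the node's verbatim; `--supports stmt-Schanuel-33363` (A₄ʰ HyperLiouvilleSchanuel). Sorry-free; standard axioms. Nothing here proves Schanuel; rung 0.
-/

set_option linter.dupNamespace false
set_option linter.unusedSectionVars false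

noncomputable section

open Complex IntermediateField Filter Polynomial
open Literature.Uncategorized (W78LogMeasure)

namespace Summit.Schanuel.Schanuel.Theorems.RootDecomp1KHyper

variable {n K : ℕ}

namespace HyperCell

variable {n K : ℕ}

open Literature.NumberTheory.Transcendental in
/-- The affine Weil height of `![x]` is at most (in fact equal to) that of the `Unit`-tuple `x`. -/
private theorem weilHeight₁_vec_le (F : IntermediateField ℚ ℂ) [FiniteDimensional ℚ F] {x : ℂ}
    (hx : x ∈ F) : weilHeight₁ F ![x] ≤ weilHeight₁ F (fun _ : Unit => x) := by
  have e : (![x] : Fin 1 → ℂ) = (fun _ : Unit => x) ∘ (fun _ : Fin 1 => ()) := by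
    funext i; simp
  rw [e]
  exact weilHeight₁_comp_le F (fun _ : Fin 1 => ()) (fun _ : Unit => x) (fun _ => hx)

open Literature.NumberTheory.Transcendental in
/-- The linear integer polynomial `den(r)·X − num(r)` of a rational number `r` is irreducible. -/
private theorem irreducible_den_mul_X_sub_num (r : ℚ) :
    Irreducible (C (r.den : ℤ) * X + C (-r.num) : ℤ[X]) := by
  have hden : (r.den : ℤ) ≠ 0 := by exact_mod_cast r.den_ne_zero
  have hdeg : (C (r.den : ℤ) * X + C (-r.num) : ℤ[X]).degree = 1 := by
    rw [degree_add_eq_left_of_degree_lt] <;> rw [degree_C_mul_X hden]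
    exact degree_C_le.trans_lt (by norm_num)
  have hprim : (C (r.den : ℤ) * X + C (-r.num) : ℤ[X]).IsPrimitive := by
    intro c hc
    rw [C_dvd_iff_dvd_coeff] at hc
    have h1 : c ∣ (r.den : ℤ) := by
      have := hc 1
      rwa [coeff_add, coeff_C_mul, coeff_X_one, mul_one, coeff_C, if_neg one_ne_zero,
        add_zero] at this
    have h0 : c ∣ r.num := by
      have := hc 0
      rwa [coeff_add, coeff_C_mul, coeff_X_zero, mul_zero, zero_add, coeff_C_zero, dvd_neg] at this
    obtain ⟨u, v, huv⟩ := Rat.isCoprime_num_den r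
    exact isUnit_of_dvd_one
      (huv ▸ dvd_add (dvd_mul_of_dvd_right h0 u) (dvd_mul_of_dvd_right h1 v))
  rw [hprim.irreducible_iff_irreducible_map_fraction_map (K := ℚ)]
  apply irreducible_of_degree_eq_one
  rwa [degree_map_eq_of_injective (algebraMap ℤ ℚ).injective_int]

open Literature.NumberTheory.Transcendental in
/-- `h_F(r) ≤ log max(|num r|, den r)` for a rational number `r` in any number field `F ⊂ ℂ`
(equality holds; the inequality is what is used). -/
private theorem weilHeight₁_ratCast_le (F : IntermediateField ℚ ℂ) [FiniteDimensional ℚ F] (r : ℚ)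
    (hr : (r : ℂ) ∈ F) :
    weilHeight₁ F (fun _ : Unit => (r : ℂ)) ≤ Real.log (max (|(r.num : ℝ)|) (r.den : ℝ)) := by
  have hden : (r.den : ℤ) ≠ 0 := by exact_mod_cast r.den_ne_zero
  have hPdeg : (C (r.den : ℤ) * X + C (-r.num) : ℤ[X]).natDegree = 1 := by
    rw [natDegree_add_C, natDegree_C_mul_X _ hden]
  have hroot : aeval (r : ℂ) (C (r.den : ℤ) * X + C (-r.num) : ℤ[X]) = 0 := by
    rw [map_add, map_mul, aeval_X, aeval_C, aeval_C, algebraMap_int_eq, eq_intCast, eq_intCast,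
      Int.cast_neg, Int.cast_natCast]
    have : (r : ℂ) * (r.den : ℂ) = (r.num : ℂ) := by exact_mod_cast Rat.mul_den_eq_num r
    linear_combination this
  have h1 := RoyWaldschmidt1997.MahlerWeil.weilHeight₁_root_le _ (irreducible_den_mul_X_sub_num r)
    (by rw [hPdeg]; exact one_pos) hroot F hr
  have hmap : (C (r.den : ℤ) * X + C (-r.num) : ℤ[X]).map (Int.castRingHom ℂ) =
      C (r.den : ℂ) * X + C (-(r.num : ℂ)) := by
    simp [Polynomial.map_add, Polynomial.map_mul]
  have hM : ((C (r.den : ℤ) * X + C (-r.num) : ℤ[X]).map (Int.castRingHom ℂ)).mahlerMeasure =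
      max (|(r.num : ℝ)|) (r.den : ℝ) := by
    rw [hmap, mahlerMeasure_C_mul_X_add_C (by exact_mod_cast r.den_ne_zero), norm_neg,
      Complex.norm_natCast, Complex.norm_intCast, max_comm]
  rw [hM, hPdeg, Nat.cast_one, div_one] at h1
  exact h1

open Literature.NumberTheory.Transcendental in
/-- `log 16 ≥ e` (so `Y ≥ log 16` is an admissible `E` in NW 1996). -/
private theorem exp_one_le_log_sixteen : Real.exp 1 ≤ Real.log 16 := by
  have h1 := Real.exp_one_lt_d9
  have h2 := Real.log_two_gt_d9
  have h16 : Real.log 16 = (4 : ℕ) * Real.log 2 := by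
    rw [show (16 : ℝ) = 2 ^ 4 by norm_num, Real.log_pow]
  rw [h16]; push_cast; linarith

open Literature.NumberTheory.Transcendental in
/-- **(H) ⇒ hX.** The explicit rational-exponent approximation measure for `exp` follows from the
registered Literature fact NW 1996 Theorem 5 (1). -/
theorem explicitRatExpApprox_of_NW1996 (hNW : NesterenkoWaldschmidt1996_thm_5_1) :
    ExplicitRatExpApprox := by
  intro r hr Q hQ hn ξ hξ Y hY16 hMY
  -- numerics of `Y`
  have heY : Real.exp 1 ≤ Y := exp_one_le_log_sixteen.trans hY16
  have hY1 : 1 < Y := by linarith [Real.add_one_le_exp (1 : ℝ)]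
  have hY0 : 0 < Y := by linarith
  have hL1 : 1 ≤ Real.log Y := (Real.le_log_iff_exp_le hY0).mpr heY
  have hL0 : 0 < Real.log Y := by linarith
  have hn1 : (1 : ℝ) ≤ Q.natDegree := by exact_mod_cast hn
  have hn0 : (0 : ℝ) < Q.natDegree := by linarith
  have hln0 : 0 ≤ Real.log Q.natDegree := Real.log_nonneg hn1
  -- algebraic data
  have hξalg : IsAlgebraic ℚ ξ := by
    refine ⟨Q.map (Int.castRingHom ℚ),
      (Polynomial.map_ne_zero_iff (Int.castRingHom ℚ).injective_int).mpr hQ.ne_zero, ?_⟩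
    rw [← algebraMap_int_eq, aeval_map_algebraMap]; exact hξ
  have hralg : IsAlgebraic ℚ (r : ℂ) := by
    have := isAlgebraic_algebraMap (R := ℚ) (A := ℂ) r
    rwa [eq_ratCast] at this
  have hr0 : (r : ℂ) ≠ 0 := by exact_mod_cast hr
  have hKeq : IntermediateField.adjoin ℚ ({ξ, (r : ℂ)} : Set ℂ) =
      IntermediateField.adjoin ℚ ({ξ} : Set ℂ) := by
    apply le_antisymm
    · rw [IntermediateField.adjoin_le_iff]
      intro x hx
      rcases Set.mem_insert_iff.mp hx with rfl | hx'
      · exact IntermediateField.mem_adjoin_simple_self ℚ _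
      · rw [Set.mem_singleton_iff.mp hx', SetLike.mem_coe, ← eq_ratCast (algebraMap ℚ ℂ) r]
        exact (IntermediateField.adjoin ℚ ({ξ} : Set ℂ)).algebraMap_mem r
    · exact IntermediateField.adjoin.mono ℚ _ _ (Set.singleton_subset_iff.mpr (Set.mem_insert ξ _))
  have hD : Module.finrank ℚ (IntermediateField.adjoin ℚ ({ξ} : Set ℂ)) = Q.natDegree :=
    NesterenkoWaldschmidt1996.finrank_adjoin_eq_natDegree hQ hn hξ
  haveI : FiniteDimensional ℚ (IntermediateField.adjoin ℚ ({ξ} : Set ℂ)) :=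
    IntermediateField.adjoin.finiteDimensional (isAlgebraic_iff_isIntegral.mp hξalg)
  have hξK : ξ ∈ IntermediateField.adjoin ℚ ({ξ} : Set ℂ) :=
    IntermediateField.mem_adjoin_simple_self ℚ ξ
  have hrK : (r : ℂ) ∈ IntermediateField.adjoin ℚ ({ξ} : Set ℂ) := by
    rw [← eq_ratCast (algebraMap ℚ ℂ) r]
    exact (IntermediateField.adjoin ℚ ({ξ} : Set ℂ)).algebraMap_mem r
  -- heights
  set H : ℝ := Real.log (max (|(r.num : ℝ)|) (r.den : ℝ)) with hHdef
  have hden1 : (1 : ℝ) ≤ r.den := by exact_mod_cast r.pos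
  have hH0 : 0 ≤ H := Real.log_nonneg (le_max_of_le_right hden1)
  have hhξ : weilHeight₁ (IntermediateField.adjoin ℚ ({ξ} : Set ℂ)) ![ξ] ≤ Y / Q.natDegree :=
    (weilHeight₁_vec_le _ hξK).trans
      ((RoyWaldschmidt1997.MahlerWeil.weilHeight₁_root_le Q hQ hn hξ _ hξK).trans
        (div_le_div_of_nonneg_right hMY hn0.le))
  have hhr : weilHeight₁ (IntermediateField.adjoin ℚ ({ξ} : Set ℂ)) ![(r : ℂ)] ≤ H :=
    (weilHeight₁_vec_le _ hrK).trans (weilHeight₁_ratCast_le _ r hrK)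
  -- parameters `E := Y`, `log A := m Y / n`
  set m : ℝ := max 1 |(r : ℝ)| with hmdef
  have hm1 : 1 ≤ m := le_max_left _ _
  have hm0 : 0 < m := by linarith
  have hceil0 : (0 : ℝ) ≤ ((⌈|(r : ℝ)|⌉₊ : ℕ) : ℝ) := Nat.cast_nonneg _
  have hceil : |(r : ℝ)| ≤ ((⌈|(r : ℝ)|⌉₊ : ℕ) : ℝ) := Nat.le_ceil _
  set g : ℝ := ((⌈|(r : ℝ)|⌉₊ : ℕ) : ℝ) + 2 with hgdef
  have hg2 : 2 ≤ g := by rw [hgdef]; linarith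
  have hg0 : 0 ≤ g := by linarith
  have hmg : m ≤ g - 1 := by
    rw [hmdef, hgdef]
    exact max_le (by linarith) (by linarith)
  set ℓA : ℝ := m * Y / Q.natDegree with hℓA
  have hYn : Y / Q.natDegree ≤ ℓA :=
    div_le_div_of_nonneg_right (le_mul_of_one_le_left hY0.le hm1) hn0.le
  have hA : 0 < Real.exp ℓA := Real.exp_pos _
  -- instantiate the fact
  have h5 := hNW ξ (r : ℂ) hξalg hralg hr0
  rw [hKeq, hD] at h5
  have hc1 : weilHeight₁ (IntermediateField.adjoin ℚ ({ξ} : Set ℂ)) ![ξ] ≤ Real.log (Real.exp ℓA) := by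
    rw [Real.log_exp]; exact hhξ.trans hYn
  have hc2 : ((Q.natDegree : ℕ) : ℝ)⁻¹ * Real.log Y ≤ Real.log (Real.exp ℓA) := by
    rw [Real.log_exp]
    calc ((Q.natDegree : ℕ) : ℝ)⁻¹ * Real.log Y ≤ ((Q.natDegree : ℕ) : ℝ)⁻¹ * Y := by
          gcongr; linarith [Real.log_le_sub_one_of_pos hY0]
      _ = Y / Q.natDegree := inv_mul_eq_div _ _
      _ ≤ ℓA := hYn
  have hc3 : ((Q.natDegree : ℕ) : ℝ)⁻¹ * ‖(r : ℂ)‖ * Y ≤ Real.log (Real.exp ℓA) := by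
    rw [Real.log_exp, Complex.norm_ratCast, hℓA,
      show ((Q.natDegree : ℕ) : ℝ)⁻¹ * |(r : ℝ)| * Y = |(r : ℝ)| * Y / Q.natDegree by ring]
    gcongr
    exact le_max_right _ _
  have h := h5 (Real.exp ℓA) Y hA hY0 heY (max_le hc1 (max_le hc2 hc3))
  rw [Real.log_exp] at h
  refine le_trans (Real.exp_le_exp.mpr (neg_le_neg ?_)) h
  -- the exponent comparison
  set S : ℝ := Real.log Y + Real.log Q.natDegree with hSdef
  have hS1 : 1 ≤ S := by linarith
  have hF : weilHeight₁ (IntermediateField.adjoin ℚ ({ξ} : Set ℂ)) ![(r : ℂ)] +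
      Real.log (max 1 ℓA) + Real.log Q.natDegree + Real.log Y ≤ (H + g + 2) * S := by
    have hmY1 : 1 ≤ m * Y := one_le_mul_of_one_le_of_one_le hm1 hY1.le
    have hℓmY : ℓA ≤ m * Y := by
      rw [hℓA]; exact div_le_self (by positivity) hn1
    have hmax1 : max 1 ℓA ≤ m * Y := max_le hmY1 hℓmY
    have hlogmax : Real.log (max 1 ℓA) ≤ Real.log m + Real.log Y := by
      rw [← Real.log_mul hm0.ne' hY0.ne']
      exact Real.log_le_log (lt_of_lt_of_le one_pos (le_max_left _ _)) hmax1
    have hlogm : Real.log m ≤ g - 2 := by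
      linarith [Real.log_le_sub_one_of_pos hm0]
    have hHg : 0 ≤ H + g := by linarith
    have hk : (H + g) * 1 ≤ (H + g) * S := mul_le_mul_of_nonneg_left hS1 hHg
    linarith
  have hG : (Q.natDegree : ℝ) * Real.log Q.natDegree + Real.log Y ≤ Q.natDegree * S := by
    have hk2 : 1 * Real.log Y ≤ (Q.natDegree : ℝ) * Real.log Y :=
      mul_le_mul_of_nonneg_right hn1 hL0.le
    rw [hSdef]
    linarith
  have hcoef : 105500 * m * (H + g + 2) ≤ 1280000000 * g * (1 + (20 + g + H)) ^ 2 := by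
    have hx1 : 1 ≤ 1 + (20 + g + H) := by linarith
    have hx0 : 0 ≤ 1 + (20 + g + H) := by linarith
    have h1 : 105500 * m * (H + g + 2) ≤ 105500 * g * (1 + (20 + g + H)) :=
      mul_le_mul (mul_le_mul_of_nonneg_left (by linarith) (by norm_num)) (by linarith)
        (by linarith) (by linarith)
    have h2 : 1 + (20 + g + H) ≤ (1 + (20 + g + H)) ^ 2 := le_self_pow₀ hx1 two_ne_zero
    have h3 : 105500 * g * (1 + (20 + g + H)) ≤ 1280000000 * g * (1 + (20 + g + H)) ^ 2 :=
      mul_le_mul (mul_le_mul_of_nonneg_right (by norm_num) hg0) h2 hx0 (by linarith)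
    exact h1.trans h3
  have hX₀ : C₀rat r * (Q.natDegree : ℝ) ^ 2 * Y * (Real.log Y + Real.log Q.natDegree) ^ 2 /
      Real.log Y ^ 2 = (1280000000 * g * (1 + (20 + g + H)) ^ 2) *
        ((Q.natDegree : ℝ) ^ 2 * Y * S ^ 2 / Real.log Y ^ 2) := by
    rw [show C₀rat r = 1280000000 * g * (1 + (20 + g + H)) ^ 2 from rfl, hSdef]; ring
  have hT0 : 0 ≤ (Q.natDegree : ℝ) ^ 2 * Y * S ^ 2 / Real.log Y ^ 2 := by positivity
  rw [hX₀]
  calc 105500 * (Q.natDegree : ℝ) ^ 2 * (m * Y / Q.natDegree) *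
        (weilHeight₁ (IntermediateField.adjoin ℚ ({ξ} : Set ℂ)) ![(r : ℂ)] +
          Real.log (max 1 (m * Y / Q.natDegree)) + Real.log Q.natDegree + Real.log Y) *
        ((Q.natDegree : ℝ) * Real.log Q.natDegree + Real.log Y) / Real.log Y ^ 2
      ≤ 105500 * (Q.natDegree : ℝ) ^ 2 * (m * Y / Q.natDegree) * ((H + g + 2) * S) *
        ((Q.natDegree : ℝ) * S) / Real.log Y ^ 2 := by
        apply div_le_div_of_nonneg_right _ (by positivity)
        have ha : 0 ≤ 105500 * (Q.natDegree : ℝ) ^ 2 * (m * Y / Q.natDegree) := by positivity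
        have hFpos : 0 ≤ (H + g + 2) * S := by positivity
        have hGpos : 0 ≤ (Q.natDegree : ℝ) * Real.log Q.natDegree + Real.log Y := by positivity
        exact mul_le_mul (mul_le_mul_of_nonneg_left hF ha) hG hGpos (mul_nonneg ha hFpos)
    _ = (105500 * m * (H + g + 2)) * ((Q.natDegree : ℝ) ^ 2 * Y * S ^ 2 / Real.log Y ^ 2) := by
        field_simp
    _ ≤ (1280000000 * g * (1 + (20 + g + H)) ^ 2) *
        ((Q.natDegree : ℝ) ^ 2 * Y * S ^ 2 / Real.log Y ^ 2) :=
        mul_le_mul_of_nonneg_right hcoef hT0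

open Literature.NumberTheory.Transcendental in
/-- `(ρ, e^ρ)` algebraically independent for every hyper-Liouville `ρ` — mod NW 1996 Thm 5 (1). -/
theorem algebraicIndependent_exp_of_hyperLiouville_NW (hNW : NesterenkoWaldschmidt1996_thm_5_1)
    {ρ : ℝ} (hρ : HyperLiouville ρ) : AlgebraicIndependent ℚ ![(ρ : ℂ), cexp ρ] :=
  algebraicIndependent_exp_of_hyperLiouville (explicitRatExpApprox_of_NW1996 hNW) hρ

open Literature.NumberTheory.Transcendental in
/-- The first decided cell of A₄ʰ, `(ℓ, ℓ²)` for hyper-Liouville `ℓ` — mod NW 1996 Thm 5 (1). -/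
theorem hyperCell_sq_NW (hNW : NesterenkoWaldschmidt1996_thm_5_1) {ℓ : ℝ} (hℓ : HyperLiouville ℓ) :
    LinearIndependent ℚ ![(ℓ : ℂ), (ℓ : ℂ) ^ 2] ∧ CoordLiouvilleSpan ![(ℓ : ℂ), (ℓ : ℂ) ^ 2] ∧
      LinLiouville ![(ℓ : ℂ), (ℓ : ℂ) ^ 2] ∧ HyperLinLiouville ![(ℓ : ℂ), (ℓ : ℂ) ^ 2] ∧
      SB 2 ![(ℓ : ℂ), (ℓ : ℂ) ^ 2] :=
  hyperCell_sq (explicitRatExpApprox_of_NW1996 hNW) hℓ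

open Literature.NumberTheory.Transcendental in
/-- The EXPLICIT decided cell `(λ_H, λ_H²)`, `λ_H = Σ 2^{-3^{k²}}` — mod NW 1996 Thm 5 (1) only. -/
theorem lambdaH_sq_cell_NW (hNW : NesterenkoWaldschmidt1996_thm_5_1) :
    LinearIndependent ℚ ![(lambdaH : ℂ), (lambdaH : ℂ) ^ 2] ∧
      CoordLiouvilleSpan ![(lambdaH : ℂ), (lambdaH : ℂ) ^ 2] ∧
      LinLiouville ![(lambdaH : ℂ), (lambdaH : ℂ) ^ 2] ∧
      HyperLinLiouville ![(lambdaH : ℂ), (lambdaH : ℂ) ^ 2] ∧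
      SB 2 ![(lambdaH : ℂ), (lambdaH : ℂ) ^ 2] :=
  lambdaH_sq_cell (explicitRatExpApprox_of_NW1996 hNW)

open Literature.NumberTheory.Transcendental in
/-- The hyper-Liouville moment curves `(ℓ, ℓ², …, ℓⁿ)`, every level — mod NW 1996 Thm 5 (1). -/
theorem hyperCell_momentCurve_NW (hNW : NesterenkoWaldschmidt1996_thm_5_1) {ℓ : ℝ}
    (hℓ : HyperLiouville ℓ) {n : ℕ} (hn : 2 ≤ n) :
    LinearIndependent ℚ (fun i : Fin n => (ℓ : ℂ) ^ ((i : ℕ) + 1)) ∧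
      CoordLiouvilleSpan (fun i : Fin n => (ℓ : ℂ) ^ ((i : ℕ) + 1)) ∧
      LinLiouville (fun i : Fin n => (ℓ : ℂ) ^ ((i : ℕ) + 1)) ∧
      HyperLinLiouville (fun i : Fin n => (ℓ : ℂ) ^ ((i : ℕ) + 1)) ∧
      SB n (fun i : Fin n => (ℓ : ℂ) ^ ((i : ℕ) + 1)) :=
  hyperCell_momentCurve (explicitRatExpApprox_of_NW1996 hNW) hℓ hn

open Literature.NumberTheory.Transcendental in
/-- **A₄ʰ at every level ≤ 2, mod registered facts + the one typed leaf `DarkWeakMeasure`.** -/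
theorem hyperLiouvilleSchanuel_le_two_NW (hW : WMeasure) (hlm : W78LogMeasure)
    (hNW : NesterenkoWaldschmidt1996_thm_5_1) (hD : DarkWeakMeasure) {n : ℕ} (hn : n ≤ 2)
    (z : Fin n → ℂ) (hz : LinearIndependent ℚ z) (hH : HyperLinLiouville z) : SB n z :=
  hyperLiouvilleSchanuel_le_two_of_darkWeakMeasure hW hlm (explicitRatExpApprox_of_NW1996 hNW) hD
    hn z hz hH

end HyperCell

end Summit.Schanuel.Schanuel.Theorems.RootDecomp1KHyper
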